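import Summits.HodgeConjecture.HodgeConjecture.Theorems.CurveNetMordellWeilVerticalSupportMiddleReduction
import Summits.HodgeConjecture.HodgeConjecture.Theorems.CurveNetMordellWeilVerticalSupportFourfoldsStubTransferConverse
import Summits.HodgeConjecture.HodgeConjecture.Theorems.CurveNetMordellWeilDeligneDescent
import Summits.HodgeConjecture.HodgeConjecture.Theorems.CurveNetMordellWeilLefschetzOneOneClose
import Summits.HodgeConjecture.HodgeConjecture.Theorems.CurveNetMordellWeilComplexOrientationExists

/-!
# Birth skeleton (BC3) of piece P₂ `HodgeFourfoldsHeart` — HC(4;2,2) for CH₀-non-degenerate fourfolds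
(crux-strategist BC2 redirect of `VerticalSupportMiddle`, stmt-HodgeConjecture-2782, unit cstrat-stmt-HodgeConjecture-2782-r1,
2026-08-17; to be re-registered against the child item `CurveNetMordellWeil.HodgeFourfoldsHeart` once the split lands —
replace the local `abbrev HodgeFourfoldsHeart` by `open Summit.HodgeConjecture.HodgeConjecture.Theses.CurveNetMordellWeil
(HodgeFourfoldsHeart)`; the composition then concludes the route decl BY NAME with the same proof)

THE ROUTE'S OWN PLAN AT `n = 4` (thesis: curve nets + vertical support + descent, calibration ground = crux #4):
every smooth projective fourfold `X` acquires a curve net `X' → ℙ³` after blowing up the base points of a general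
net (`stub_curveNetExists` = the route's support item `CurveNetExists`, stmt-HodgeConjecture-2788, construction);
on `X'` every rational `(2,2)`-class is algebraic modulo classes supported over a proper closed `T ⊂ ℙ³`
(`stub_verticalSupportFourfolds` = the route's crux #4 `VerticalSupportFourfolds`, stmt-HodgeConjecture-2784: ONE
descent step — vertical classes over a surface `T` are Mordell–Weil classes of Jacobian fibrations over surfaces;
registered lines `anchor-transport-42`, `qbar-envelope-42` on that crux); vertical ⟹ algebraic at `n = 4` is a
THEOREM of the tree (Deligne descent `deligneDescent_of_facts` over the discharged facts + Lefschetz (1,1)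
`lefschetzOneOne_proof`, assembled in the landed `hodgeTwoTwo_le_algebraicClasses_of_verticalSupportFourfolds`), and
`σ_*` carries algebraic classes back to `X` (the route's PROVED item `GysinPreservesAlgebraic`). Hence
`HodgeFourfoldsHeart_of : CurveNetExists → VerticalSupportFourfolds → HodgeFourfoldsHeart`, PROVED below; in fact the
two stubs give HC(4;2,2) for ALL fourfolds (`hodgeFourfolds_of_stubs`) — the CH₀-hypothesis of the piece only
separates off the CH₀-degenerate regime, which is the sibling piece P₁ (a theorem modulo the Gysin debts).

Neither stub is the piece or the summit: `CurveNetExists` is a construction statement (blow-ups), true and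
Hodge-conjecture-free; `VerticalSupportFourfolds` is HC(4;2,2) in the route's net language (equivalent to HC(4;2,2)
only THROUGH nets + descent + Gysin — `stub → piece` / `stub → S` probes fail, `bc/stub_probes_p2.lean`).
Both stubs are existing items of this route (2788 support, 2784 crux rank 4): the birth puts crux #4 — so far outside
the cone of `closes` — into the registered skeleton of a load-bearing leaf.
-/

noncomputable section

set_option linter.dupNamespace false

open CategoryTheory AlgebraicGeometry
open Literature.AlgebraicGeometry Literature.AlgebraicGeometry.Motives
  Literature.AlgebraicGeometry.HodgeTheory Literature.AlgebraicTopology.SingularHomology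
open Summit.HodgeConjecture.HodgeConjecture.Theorems
open Summit.HodgeConjecture.HodgeConjecture.Theorems.RegimeSplit
open Summit.HodgeConjecture.HodgeConjecture.Theses.CurveNetMordellWeil
  (CurveNetExists VerticalSupportFourfolds DeligneDescent LefschetzOneOne GysinPreservesAlgebraic)

namespace Summit.HodgeConjecture.HodgeConjecture.Cruxes.VerticalSupportMiddle.LevelRegimeSplit.P2Birth

/-- The piece (local copy, verbatim the text of the future route item `CurveNetMordellWeil.HodgeFourfoldsHeart`). -/
abbrev HodgeFourfoldsHeart : Prop :=
  ∀ ⦃X : Literature.AlgebraicGeometry.Motives.SchemeOver ℂ⦄, Literature.AlgebraicGeometry.Motives.IsSmoothProjective 4 X → ¬ (∃ W : Set X.left, IsClosed W ∧ W ≠ Set.univ ∧ ∀ z ∈ Literature.AlgebraicGeometry.Motives.cyclesOfDim X.left 0, ∃ z' ∈ Literature.AlgebraicGeometry.Motives.cyclesOfDim X.left 0, (∀ x, z' x ≠ 0 → x ∈ W) ∧ Literature.AlgebraicGeometry.Motives.IsRationallyEquivalent z z' 0) → ∀ c : Literature.AlgebraicGeometry.HodgeTheory.complexBetti X (2 * 2),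 Literature.AlgebraicGeometry.HodgeTheory.IsRationalClass c → Literature.AlgebraicGeometry.HodgeTheory.IsOfHodgeType 4 X (2 * 2) 2 2 c → c ∈ Literature.AlgebraicGeometry.HodgeTheory.algebraicClasses X 2

/-! ### Stubs -/

/-- **Stub 1: generic curve nets exist** — the route's support item `CurveNetExists` (stmt-HodgeConjecture-2788) BY
NAME: for `X` smooth projective of dimension `n ≥ 2` and `m + 1 = n` there are a smooth projective `X'`, `σ : X' → X`
and a SURJECTIVE `pr : X' → ℙ^m` with the rational `(q,q)`-classes of `X` inside `σ_*` of those of `X'` (blow up the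
reduced base points of a general net in `|O_X(d)|`; `σ_*σ^* = id` up to a unit). Construction statement, HC-free.
[size L: blow-ups of finitely many reduced points in the `Motives.SchemeOver` setting + `σ_*σ^*`]
[cite: VoisinHodgeII2003, §2.1] [cite: Hartshorne1977, II.7] -/
theorem stub_curveNetExists : CurveNetExists := by
  sorry

/-- **Stub 2: vertical support on fourfolds** — the route's crux #4 `VerticalSupportFourfolds` (stmt-HodgeConjecture-2784)
BY NAME: `X` smooth projective fourfold, `pr : X → ℙ³` surjective ⟹ every rational `(2,2)`-class is algebraic modulo
rational `(2,2)`-classes supported over a proper closed `T ⊂ ℙ³` (Mordell–Weil classes of Jacobian fibrations over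
surfaces + fibre components). Open = HC(4;2,2) in the net language; registered lines `anchor-transport-42` /
`qbar-envelope-42` (V42 ∧ An42, E42 ∧ HCQ̄²). [size: open-problem at dimension 4]
[cite: Zucker1977] [cite: ConteMurre1978] [cite: Markman2025SecantWeil] [cite: Arapura2022] -/
theorem stub_verticalSupportFourfolds : VerticalSupportFourfolds := by
  sorry

/-! ### Tree theorems used by name (no sorry) -/

/-- The route item `DeligneDescent` holds in the tree (both named facts are discharged). [cite: DeligneHodgeIII1974, Cor. 8.2.8]
[cite: Voisin2025, Cor. 2.12] -/
theorem deligneDescent_holds : DeligneDescent :=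
  deligneDescent_of_facts Deligne1974_ker_restrictCompl_eq_iSup_range_complexGysin_holds
    Voisin2025_hodgeClass_lift_complexGysin_holds

/-! ### Composition -/

/-- **The two stubs give HC(4;2,2) on EVERY smooth projective fourfold**: net (`CurveNetExists` at `n = 4`, `m = 3`),
vertical support on the total space (`VerticalSupportFourfolds`), vertical ⟹ algebraic
(`hodgeTwoTwo_le_algebraicClasses_of_verticalSupportFourfolds`, descent + Lefschetz (1,1), landed), push down by `σ_*`
(`GysinPreservesAlgebraic`, proved item). [cite: DeligneHodgeIII1974, Cor. 8.2.8] [cite: VoisinHodgeI2002, Thm. 11.30] -/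
theorem hodgeFourfolds_of_stubs (hNet : CurveNetExists) (hVSF : VerticalSupportFourfolds) ⦃X : SchemeOver ℂ⦄
    (hX : IsSmoothProjective 4 X) (c : complexBetti X (2 * 2)) (hc : IsRationalClass c)
    (hh : IsOfHodgeType 4 X (2 * 2) 2 2 c) : c ∈ algebraicClasses X 2 := by
  obtain ⟨μ, hμ⟩ := complexOrientationExists_proof
  obtain ⟨X', hX', σ, pr, hsurj, hle⟩ := hNet μ hμ hX (by norm_num) (show 3 + 1 = 4 by norm_num)
  have step := hodgeTwoTwo_le_algebraicClasses_of_verticalSupportFourfolds deligneDescent_holds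
    lefschetzOneOne_proof hVSF pr hX' hsurj
  have hGys : GysinPreservesAlgebraic := curveNetMordellWeil_gysinPreservesAlgebraic_proof
  exact ((hle 2).trans ((Submodule.map_mono step).trans (hGys μ hμ hX' hX σ (show 4 + 0 = 4 by norm_num))))
    (Submodule.subset_span ⟨hc, hh⟩)

/-- **BIRTH COMPOSITION: the two stubs → the piece `HodgeFourfoldsHeart`** (the CH₀-hypothesis is not needed by this
plan; it only separates off the sibling piece P₁). [cite: DeligneHodgeIII1974, Cor. 8.2.8] [cite: Zucker1977] -/
theorem HodgeFourfoldsHeart_of : CurveNetExists → VerticalSupportFourfolds → HodgeFourfoldsHeart :=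
  fun hNet hVSF _ hX _ c hc hh ↦ hodgeFourfolds_of_stubs hNet hVSF hX c hc hh

/-- The piece, closed modulo exactly the two stubs. -/
theorem HodgeFourfoldsHeart_of_stubs : HodgeFourfoldsHeart :=
  HodgeFourfoldsHeart_of stub_curveNetExists stub_verticalSupportFourfolds

/-! ### Sanity -/

/-- Converse bookkeeping: HC(4;2,2) on a fourfold with a net gives stub 2's conclusion for that net (trivially:
algebraic classes are the first summand) — landed `verticalSupportFourfolds_of_hodgeTwoTwo`. So stub 2 ⟺ HC(4;2,2)
only THROUGH stub 1 + descent + Gysin, never alone. [folklore] -/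
theorem verticalSupportFourfolds_of_hodgeFourfolds
    (h : ∀ ⦃X : SchemeOver ℂ⦄, IsSmoothProjective 4 X → ∀ c : complexBetti X (2 * 2), IsRationalClass c →
      IsOfHodgeType 4 X (2 * 2) 2 2 c → c ∈ algebraicClasses X 2) :
    VerticalSupportFourfolds :=
  fun _ pr hX _ ↦ verticalSupportFourfolds_of_hodgeTwoTwo pr (Submodule.span_le.2 fun c hc ↦ h hX c hc.1 hc.2)

/-- The piece is HC-true. [cite: Deligne2000, §1] -/
theorem hodgeFourfoldsHeart_of_hodgeConjecture (h : _root_.HodgeConjecture) : HodgeFourfoldsHeart :=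
  fun _ hX _ c hc hh ↦ (h hX).2 2 c hc hh

end Summit.HodgeConjecture.HodgeConjecture.Cruxes.VerticalSupportMiddle.LevelRegimeSplit.P2Birth

end
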